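import Summits.FinalStateConjecture.FinalStateConjecture.Theorems.WeakCosmicCensorshipMGHD.Negative.ConstraintsLoadBearing
import Summits.FinalStateConjecture.FinalStateConjecture.Theorems.WeakCosmicCensorshipMGHD.Negative.LoadBearing
import Summits.FinalStateConjecture.FinalStateConjecture.Theorems.WeakCosmicCensorshipMGHD.Negative.TruncatedMinkowski
import Literature.Geometry.Lorentzian.TameGenericity
import Literature.Geometry.Lorentzian.TrivialDataAdmissible

/-!
# `WeakCosmicCensorshipTame` (crux `stmt-FinalStateConjecture-17269`, route `PhaseMixingCapture`,
# rank 5), negative-side support II: refutation shape and load-bearing hypotheses of the TAME crux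

Support file of the crux disprover (cdisprove seat, cycle 1, 2026-08-17), `sorry`-free, no named
facts, no definitions. The crux is, `Σ` by `Σ`, TAME Christodoulou-genericity (codimension `≥ 1`,
`InitialDataSet.IsTameChristodoulouGeneric`) inside `admissibleVacuumData Σ` of the censored
property "a maximal vacuum Cauchy development exists and every MGHD has complete `𝓘⁺` (sojourn
form)". Its only delta against the pre-revision crux `WeakCosmicCensorshipMGHD` (stmt-9952) is the
witness notion (tame curves instead of arbitrary jointly smooth curves); tame genericity forgets to
plain genericity (`IsTameChristodoulouGeneric.isChristodoulouGeneric`), so every falsity result for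
a variant of the old crux transfers to the same variant of the new one. This file records:

* `not_isTameGeneric_iff_exists_trapped` — the exact shape of a failure of the crux on one `Σ`:
  an admissible, non-censored datum `d` such that EVERY tame, immersed, injective curve of
  admissible data through `d` has a non-censored member at a nonzero parameter;
  `not_isTameGeneric_of_forall_not` — a nonempty admissible class all of whose members are
  exceptional is such a failure.
* `wccTame_false_without_constraints` — the vacuum-constraint clause of admissibility is
  load-bearing: the tame crux over the constraint-free class `admissibleNoConstraint Σ` is FALSE
  (transfer of `wcc_false_without_constraints`: `bumpData` traps every jointly smooth curve).
* `wccTameWithoutT2_false_of` — `[T2Space Σ]` is load-bearing, degenerately (transfer of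
  `wccWithoutT2_false_of`).
* `trivialData_exceptional_without_isMaximal`, `wccTame_false_without_isMaximal_of` — `IsMaximal`
  in the `∀`-clause is load-bearing: with it dropped the trivial datum is exceptional
  (time-truncated Minkowski, `Negative/TruncatedMinkowski.lean`), and modulo the true but
  unconstructed fact "every admissible datum on `ℝ³` has SOME vacuum Cauchy development with
  incomplete `𝓘⁺`" (local existence + time truncation) the whole statement is false.
* `isTameChristodoulouGeneric_admissible_zero` — the codimension scale: with parameter `0` in place
  of `1` tame genericity inside the admissible class holds for EVERY property (constant families on
  the sole end granted by admissibility); all content of the crux sits at `m = 1`.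

## References

* D. Christodoulou, CQG 16 (1999) A23, p. A24 (admissible class; positive codimension).
* Y. Choquet-Bruhat, R. Geroch, CMP 14 (1969) 329 (maximal developments).
-/

noncomputable section

-- the doubled `FinalStateConjecture.FinalStateConjecture` path component trips dupNamespace
set_option linter.dupNamespace false

open Bundle TopologicalSpace Set Function Filter
open scoped Manifold ContDiff Topology

namespace Summit.FinalStateConjecture.FinalStateConjecture.Theorems.WeakCosmicCensorshipTame.Negative

open Literature.Geometry.Lorentzian
open Literature.Geometry.Lorentzian.InitialDataSet
  (IsTameDataFamily IsImmersedAtZero IsTameChristodoulouGeneric isTameDataFamily_const)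
open Summit.FinalStateConjecture.FinalStateConjecture.Theorems.WeakCosmicCensorshipMGHD.Negative
  (admissibleNoConstraint wcc_false_without_constraints wccWithoutT2_false_of
    exists_vacuumCauchyDevelopment_trivialData_not_complete)

section Shape

variable {X : Type} [TopologicalSpace X] [ChartedSpace E3 X] [IsManifold (𝓡 3) ∞ X]

/-- **Exact shape of a failure of the tame crux on one `Σ`** (for an arbitrary property `P` of data;
the crux takes `P` = censored): tame Christodoulou-genericity of `P` inside the admissible class
fails iff some admissible datum failing `P` is TRAPPED — every tame (on some end), immersed,
injective curve of admissible data through it has a member failing `P` at a nonzero parameter.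
[cite: Christodoulou1999, p. A24] -/
theorem not_isTameGeneric_iff_exists_trapped (P : InitialDataSet (𝓡 3) X → Prop) :
    ¬ IsTameChristodoulouGeneric (admissibleVacuumData X) P 1 ↔
      ∃ d ∈ admissibleVacuumData X, ¬ P d ∧
        ∀ (e : AFEnd X) (F : EuclideanSpace ℝ (Fin 1) → InitialDataSet (𝓡 3) X),
          IsTameDataFamily e 1 F → IsImmersedAtZero 1 F → F 0 = d → Injective F →
            (∀ c, F c ∈ admissibleVacuumData X) → ∃ c, c ≠ 0 ∧ ¬ P (F c) := by
  constructor
  · intro h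
    by_contra hno
    refine h fun d hd ↦ ?_
    by_contra hnoF
    refine hno ⟨d, hd.1, hd.2, fun e F hF himm h0 hinj hadm ↦ ?_⟩
    by_contra hc
    push Not at hc
    exact hnoF ⟨e, F, hF, himm, h0, hinj, hadm, fun c hc0 hmem ↦ hmem.2 (hc c hc0)⟩
  · rintro ⟨d, hd, hnc, htrap⟩ h
    obtain ⟨e, F, hF, himm, h0, hinj, hadm, hesc⟩ := h d ⟨hd, hnc⟩
    obtain ⟨c, hc0, hc⟩ := htrap e F hF himm h0 hinj hadm
    exact hesc c hc0 ⟨hadm c, hc⟩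

/-- **A nonempty admissible class all of whose members fail `P` kills tame genericity of `P`** on
that `Σ`: the members of any would-be witness curve at `c ≠ 0` are admissible, hence exceptional.
[cite: Christodoulou1999, p. A24] -/
theorem not_isTameGeneric_of_forall_not (P : InitialDataSet (𝓡 3) X → Prop)
    {d : InitialDataSet (𝓡 3) X} (hd : d ∈ admissibleVacuumData X)
    (hall : ∀ D ∈ admissibleVacuumData X, ¬ P D) :
    ¬ IsTameChristodoulouGeneric (admissibleVacuumData X) P 1 := by
  refine (not_isTameGeneric_iff_exists_trapped P).2 ⟨d, hd, hall d hd, fun e F _ _ _ _ hadm ↦ ?_⟩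
  refine ⟨EuclideanSpace.single (0 : Fin 1) (1 : ℝ), fun h0 ↦ ?_, hall _ (hadm _)⟩
  simpa using congrArg (fun c : EuclideanSpace ℝ (Fin 1) ↦ c 0) h0

end Shape

/-- **The vacuum-constraint clause of admissibility is load-bearing: without it the TAME crux is
false.** Statement in the conclusion: `WeakCosmicCensorshipTame` with `admissibleVacuumData X`
replaced by `admissibleNoConstraint X` (the clause `D.IsVacuumConstraintSolution` deleted,
everything else verbatim). One line from `wcc_false_without_constraints`: the constraint-violating
complete AF datum `bumpData` on `ℝ³` traps every jointly smooth curve through it (the Hamiltonian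
constraint function at the origin is continuous in the parameter with value `6`), a fortiori every
tame one. [cite: Christodoulou1999, p. A24] -/
theorem wccTame_false_without_constraints :
    ¬ ∀ (X : Type) [TopologicalSpace X] [ChartedSpace E3 X] [IsManifold (𝓡 3) ∞ X] [T2Space X]
      [SecondCountableTopology X] [ConnectedSpace X],
      IsTameChristodoulouGeneric (admissibleNoConstraint X)
        (fun D ↦ (∃ 𝒟 : VacuumCauchyDevelopment D, 𝒟.IsMaximal) ∧
          ∀ 𝒟 : VacuumCauchyDevelopment D, 𝒟.IsMaximal →
            _root_.Summit.FinalStateConjecture.HasCompleteNullInfinity 𝒟.toCauchyDevelopment) 1 :=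
  fun h ↦ wcc_false_without_constraints fun X _ _ _ _ _ _ ↦ (h X).isChristodoulouGeneric

/-- **`[T2Space Σ]` is load-bearing (degenerately)**: the TAME crux with `[T2Space Σ]` deleted is
false as soon as one non-Hausdorff connected second-countable `3`-manifold carries an admissible
datum (no datum on it has a vacuum Cauchy development, data embeddings landing in Hausdorff
spacetimes). Transfer of `wccWithoutT2_false_of`. [cite: ChoquetBruhatGeroch1969CMP, p. 330] -/
theorem wccTameWithoutT2_false_of
    (H : ∃ (Y : Type) (_ : TopologicalSpace Y) (_ : ChartedSpace E3 Y)
      (_ : IsManifold (𝓡 3) ∞ Y) (_ : SecondCountableTopology Y) (_ : ConnectedSpace Y),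
      ¬ T2Space Y ∧ (admissibleVacuumData Y).Nonempty) :
    ¬ ∀ (X : Type) [TopologicalSpace X] [ChartedSpace E3 X] [IsManifold (𝓡 3) ∞ X]
      [SecondCountableTopology X] [ConnectedSpace X],
      IsTameChristodoulouGeneric (admissibleVacuumData X)
        (fun D ↦ (∃ 𝒟 : VacuumCauchyDevelopment D, 𝒟.IsMaximal) ∧
          ∀ 𝒟 : VacuumCauchyDevelopment D, 𝒟.IsMaximal →
            _root_.Summit.FinalStateConjecture.HasCompleteNullInfinity 𝒟.toCauchyDevelopment) 1 :=
  fun h ↦ wccWithoutT2_false_of H fun X _ _ _ _ _ ↦ (h X).isChristodoulouGeneric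

/-- **`IsMaximal` is load-bearing, step 1: with `IsMaximal` dropped from the `∀`-clause the trivial
datum is exceptional** — the time-truncated Minkowski space `{x⁰ < 1}` is a vacuum Cauchy
development of `(ℝ³, δ, 0)` with incomplete `𝓘⁺` in the sojourn form
(`Negative/TruncatedMinkowski.lean`). [cite: Christodoulou1999, p. A27] -/
theorem trivialData_exceptional_without_isMaximal :
    ¬ ((∃ 𝒟 : VacuumCauchyDevelopment trivialData, 𝒟.IsMaximal) ∧
        ∀ 𝒟 : VacuumCauchyDevelopment trivialData,
          _root_.Summit.FinalStateConjecture.HasCompleteNullInfinity 𝒟.toCauchyDevelopment) := by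
  rintro ⟨-, hall⟩
  obtain ⟨𝒟, h𝒟⟩ := exists_vacuumCauchyDevelopment_trivialData_not_complete
  exact h𝒟 (hall 𝒟)

/-- **`IsMaximal` is load-bearing, step 2**: modulo the (true, here unconstructed) fact that every
admissible datum on `ℝ³` has SOME vacuum Cauchy development with incomplete future null infinity —
local existence (Choquet-Bruhat 1952) followed by truncation of the development in a Cauchy time
function — the TAME crux with `IsMaximal` dropped from the `∀`-clause is FALSE: every admissible
datum on `ℝ³` is then exceptional, the class is inhabited by `trivialData`, and no curve escapes.
[cite: ChoquetBruhatGeroch1969CMP, p. 330] -/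
theorem wccTame_false_without_isMaximal_of
    (H : ∀ D ∈ admissibleVacuumData Minkowski.slice, ∃ 𝒟 : VacuumCauchyDevelopment D,
      ¬ _root_.Summit.FinalStateConjecture.HasCompleteNullInfinity 𝒟.toCauchyDevelopment) :
    ¬ ∀ (X : Type) [TopologicalSpace X] [ChartedSpace E3 X] [IsManifold (𝓡 3) ∞ X] [T2Space X]
      [SecondCountableTopology X] [ConnectedSpace X],
      IsTameChristodoulouGeneric (admissibleVacuumData X)
        (fun D ↦ (∃ 𝒟 : VacuumCauchyDevelopment D, 𝒟.IsMaximal) ∧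
          ∀ 𝒟 : VacuumCauchyDevelopment D,
            _root_.Summit.FinalStateConjecture.HasCompleteNullInfinity 𝒟.toCauchyDevelopment) 1 := by
  intro hW
  refine not_isTameGeneric_of_forall_not _ trivialData_mem_admissibleVacuumData
    (fun D hD ⟨_, hcomplete⟩ ↦ ?_) (hW Minkowski.slice)
  obtain ⟨𝒟, h𝒟⟩ := H D hD
  exact h𝒟 (hcomplete 𝒟)

section Scale

variable (X : Type) [TopologicalSpace X] [ChartedSpace E3 X] [IsManifold (𝓡 3) ∞ X]

/-- **The codimension scale: `m = 0` is trivial.** With codimension parameter `0` in place of `1`,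
tame Christodoulou-genericity inside the admissible class holds for EVERY property on every `Σ`:
through an exceptional datum pass the constant `ℝ⁰`-family, tame on the sole strongly
asymptotically flat end granted by admissibility (`isTameDataFamily_const`); immersion, injectivity
and escape are vacuous over the one-point parameter space. All content of the crux sits at `m = 1`.
[cite: Christodoulou1999, p. A24] -/
theorem isTameChristodoulouGeneric_admissible_zero (P : InitialDataSet (𝓡 3) X → Prop) :
    IsTameChristodoulouGeneric (admissibleVacuumData X) P 0 := by
  intro d hd
  obtain ⟨-, e, M, hsole, hdecay⟩ := hd.1
  refine ⟨e, fun _ ↦ d, isTameDataFamily_const hsole 0 hdecay, fun v hv ↦ ?_, rfl,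
    fun a b _ ↦ Subsingleton.elim a b, fun _ ↦ hd.1, fun c hc ↦ ?_⟩
  · exact absurd (Subsingleton.elim v 0) hv
  · exact absurd (Subsingleton.elim c 0) hc

end Scale

end Summit.FinalStateConjecture.FinalStateConjecture.Theorems.WeakCosmicCensorshipTame.Negative

end
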